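import Summits.AtomisticToContinuum.Crystallization.Theorems.FreeSplittingCertificatesStrictSplittingRuleTorusParam442CertApp
import Summits.AtomisticToContinuum.Crystallization.Theorems.FreeSplittingCertificatesStrictSplittingRuleTorusParam442CertApm
import Summits.AtomisticToContinuum.Crystallization.Theorems.FreeSplittingCertificatesStrictSplittingRuleTorusParam442CertAmp
import Summits.AtomisticToContinuum.Crystallization.Theorems.FreeSplittingCertificatesStrictSplittingRuleTorusParam442CertAmm
import Summits.AtomisticToContinuum.Crystallization.Theorems.FreeSplittingCertificatesStrictSplittingRuleTorusParam442CertBpp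
import Summits.AtomisticToContinuum.Crystallization.Theorems.FreeSplittingCertificatesStrictSplittingRuleTorusParam442CertBpm
import Summits.AtomisticToContinuum.Crystallization.Theorems.FreeSplittingCertificatesStrictSplittingRuleTorusParam442CertBmp
import Summits.AtomisticToContinuum.Crystallization.Theorems.FreeSplittingCertificatesStrictSplittingRuleTorusParam442CertBmm
import Summits.AtomisticToContinuum.Crystallization.Theorems.FreeSplittingCertificatesStrictSplittingRuleHcpFamilyMinLocalised

/-!
# The BOX THEOREM for the 4×4×2 torus model (assembly modulo the eight corner certificates)

Route `FreeSplittingCertificates`, crux `StrictSplittingRule` (stmt-AtomisticToContinuum-12560); unit b2b-freesplit-B (PART B, gen 3).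
VALUE = a theorem about a FINITE model — NOT summit progress; the registered stub `stub_coreJointCoercive` (H12⋆) is untouched.

`boxA_of_corners` / `boxB_of_corners`: given the four corner certificates of a parity (`0 ≤ evalQR (cornerA ±1 ±1) v`, each ONE
`native_decide` in its own computational file), for EVERY `(a,h)` with `|a − a₀| ≤ 10⁻⁴`, `|h − h₀| ≤ 10⁻⁴` and every real
`v = (u, θ) : Fin 195 → ℝ`:
`evalQR EA v ≤ evalS tsA (k ↦ monoVal (keyAtoms keysA k) a h) v`, i.e.
`(β-box readout majorant)(v) + (1/30)·‖u‖²_G − Π(u) ≤ S_p(a,h)(v) + T_p(v) − κ_p(a,h)(v) − R_p(a,h,β̄)(v) + μ·Σ_k (J_kk(a,h)θ_k − RHS_k(a,h)(u))²`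
— the symbolic 4×4×2 model of `…TorusParamModel442` EVALUATED AT `(a,h)` (every monomial `a^i h^j W′/W″(σa²+τh²)` at its real
value), with the co-rotation `θ` free and the least-squares constraint as a penalty that vanishes at `θ = Θ(a,h)u`.  With
`hcpFamilyMin_enclosure` this holds in particular AT THE EXACT hcp-family minimiser.  Ingredients: `evalS_ge_of_corners`
(…TorusParamSym), `monoEnclQ_encl` (…TorusParamEnclosureData; all 308 keys' atoms admissible — `keysA_ok`, `decide`d by
evaluation), `abs_evalQR_le_absTerms` (…TorusParamGlue).  [folklore]
-/

namespace Summit.AtomisticToContinuum.Crystallization.Theorems.StrictSplittingRuleTorusLMI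

namespace Param442

open Literature.Computation.Certificates

/-- `0 < Δ`. [folklore] -/
theorem dq_pos : 0 < dq := by norm_num [dq]
/-- `Δ ≤ a₀`. [folklore] -/
theorem dq_le_a0 : dq ≤ a0q := by norm_num [dq, a0q]
/-- `Δ ≤ h₀`. [folklore] -/
theorem dq_le_h0 : dq ≤ h0q := by norm_num [dq, h0q]

/-- The real value of key `k` of parity A at `(a,h)`. [folklore] -/
noncomputable def tA (k : Fin K) (a h : ℝ) : ℝ := monoVal (keyAtoms keysA k.val) a h
/-- The real value of key `k` of parity B at `(a,h)`. [folklore] -/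
noncomputable def tB (k : Fin K) (a h : ℝ) : ℝ := monoVal (keyAtoms keysB k.val) a h

/-- **Box theorem, parity A, modulo the four corner certificates.** [folklore] -/
theorem boxA_of_corners
    (hok : ∀ k : Fin K, ∀ x ∈ keyAtoms keysA k.val, x.ok a0q h0q dq = true)
    (hpp : ∀ v : Fin 195 → ℝ, 0 ≤ evalQR (cornerA 1 1) v) (hpm : ∀ v : Fin 195 → ℝ, 0 ≤ evalQR (cornerA 1 (-1)) v)
    (hmp : ∀ v : Fin 195 → ℝ, 0 ≤ evalQR (cornerA (-1) 1) v) (hmm : ∀ v : Fin 195 → ℝ, 0 ≤ evalQR (cornerA (-1) (-1)) v)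
    {a h : ℝ} (ha : |a - a0q| ≤ dq) (hh : |h - h0q| ≤ dq) (v : Fin 195 → ℝ) :
    evalQR EA v ≤ evalS tsA (fun k => tA k a h) v := by
  refine evalS_ge_of_corners (le_of_lt dq_pos) tsA PabsA (fun k v => abs_evalQR_le_absTerms _ v) tA
    (fun k => (enclA k).c₀) (fun k => (enclA k).c₁) (fun k => (enclA k).c₂) (fun k => (enclA k).ρ)
    (fun k => monoEnclQ_encl dq_pos dq_le_a0 dq_le_h0 _ (hok k)) EA ?_ ha hh v
  intro sa hsa sh hsh w
  simp only [Finset.mem_insert, Finset.mem_singleton] at hsa hsh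
  rcases hsa with rfl | rfl <;> rcases hsh with rfl | rfl
  · exact hpp w
  · exact hpm w
  · exact hmp w
  · exact hmm w

/-- **Box theorem, parity B, modulo the four corner certificates.** [folklore] -/
theorem boxB_of_corners
    (hok : ∀ k : Fin K, ∀ x ∈ keyAtoms keysB k.val, x.ok a0q h0q dq = true)
    (hpp : ∀ v : Fin 195 → ℝ, 0 ≤ evalQR (cornerB 1 1) v) (hpm : ∀ v : Fin 195 → ℝ, 0 ≤ evalQR (cornerB 1 (-1)) v)
    (hmp : ∀ v : Fin 195 → ℝ, 0 ≤ evalQR (cornerB (-1) 1) v) (hmm : ∀ v : Fin 195 → ℝ, 0 ≤ evalQR (cornerB (-1) (-1)) v)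
    {a h : ℝ} (ha : |a - a0q| ≤ dq) (hh : |h - h0q| ≤ dq) (v : Fin 195 → ℝ) :
    evalQR EB v ≤ evalS tsB (fun k => tB k a h) v := by
  refine evalS_ge_of_corners (le_of_lt dq_pos) tsB PabsB (fun k v => abs_evalQR_le_absTerms _ v) tB
    (fun k => (enclB k).c₀) (fun k => (enclB k).c₁) (fun k => (enclB k).c₂) (fun k => (enclB k).ρ)
    (fun k => monoEnclQ_encl dq_pos dq_le_a0 dq_le_h0 _ (hok k)) EB ?_ ha hh v
  intro sa hsa sh hsh w
  simp only [Finset.mem_insert, Finset.mem_singleton] at hsa hsh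
  rcases hsa with rfl | rfl <;> rcases hsh with rfl | rfl
  · exact hpp w
  · exact hpm w
  · exact hmp w
  · exact hmm w


/-- All atoms of all 308 keys are admissible (nondegenerate nonnegative classes), parity A — by evaluation. COMPUTATIONAL. [folklore] -/
theorem keysA_okB : ((List.finRange K).all fun k => (keyAtoms keysA k.val).all fun x => x.ok a0q h0q dq) = true := by
  native_decide
/-- The same, parity B. COMPUTATIONAL. [folklore] -/
theorem keysB_okB : ((List.finRange K).all fun k => (keyAtoms keysB k.val).all fun x => x.ok a0q h0q dq) = true := by
  native_decide

/-- Unpacking of `keysA_okB`. [folklore] -/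
theorem keysA_ok : ∀ k : Fin K, ∀ x ∈ keyAtoms keysA k.val, x.ok a0q h0q dq = true := by
  intro k x hx
  have h := keysA_okB
  rw [List.all_eq_true] at h
  have hk := h k (List.mem_finRange k)
  rw [List.all_eq_true] at hk
  exact hk x hx
/-- Unpacking of `keysB_okB`. [folklore] -/
theorem keysB_ok : ∀ k : Fin K, ∀ x ∈ keyAtoms keysB k.val, x.ok a0q h0q dq = true := by
  intro k x hx
  have h := keysB_okB
  rw [List.all_eq_true] at h
  have hk := h k (List.mem_finRange k)
  rw [List.all_eq_true] at hk
  exact hk x hx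

/-- **BOX THEOREM, parity A**: for every `(a,h)` of the certified enclosure and every `v = (u, θ) ∈ ℝ¹⁹⁵`,
`evalQR EA v ≤ evalS tsA (k ↦ monoVal (keyAtoms keysA k) a h) v` (see the module docstring for the reading). [folklore] -/
theorem boxA {a h : ℝ} (ha : |a - a0q| ≤ dq) (hh : |h - h0q| ≤ dq) (v : Fin 195 → ℝ) :
    evalQR EA v ≤ evalS tsA (fun k => tA k a h) v :=
  boxA_of_corners keysA_ok cornerApp_nonneg cornerApm_nonneg cornerAmp_nonneg cornerAmm_nonneg ha hh v

/-- **BOX THEOREM, parity B.** [folklore] -/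
theorem boxB {a h : ℝ} (ha : |a - a0q| ≤ dq) (hh : |h - h0q| ≤ dq) (v : Fin 195 → ℝ) :
    evalQR EB v ≤ evalS tsB (fun k => tB k a h) v :=
  boxB_of_corners keysB_ok cornerBpp_nonneg cornerBpm_nonneg cornerBmp_nonneg cornerBmm_nonneg ha hh v

open Summit.AtomisticToContinuum.Crystallization.Theorems.StrictSplittingRuleBirth in
/-- **At the EXACT hcp-family minimiser** (the hypothesis of the stub `stub_coreJointCoercive`): the symbolic 4×4×2 torus
model evaluated at `(a,h)` dominates `EA` (parity A) — via `hcpFamilyMin_enclosure`.  Finite model; NOT the stub. [folklore] -/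
theorem boxA_of_hcpFamilyMin {a h : ℝ} (ha : 0 < a) (hh : 0 < h) (hfam : HcpFamilyMin a h) (v : Fin 195 → ℝ) :
    evalQR EA v ≤ evalS tsA (fun k => tA k a h) v := by
  obtain ⟨h1, h2⟩ := hcpFamilyMin_enclosure ha hh hfam
  refine boxA ?_ ?_ v
  · simpa [a0q, dq] using h1
  · have : (h0q : ℝ) = 79294 / 100000 := by norm_num [h0q]
    rw [this]; simpa [dq] using h2

open Summit.AtomisticToContinuum.Crystallization.Theorems.StrictSplittingRuleBirth in
/-- The same, parity B. [folklore] -/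
theorem boxB_of_hcpFamilyMin {a h : ℝ} (ha : 0 < a) (hh : 0 < h) (hfam : HcpFamilyMin a h) (v : Fin 195 → ℝ) :
    evalQR EB v ≤ evalS tsB (fun k => tB k a h) v := by
  obtain ⟨h1, h2⟩ := hcpFamilyMin_enclosure ha hh hfam
  refine boxB ?_ ?_ v
  · simpa [a0q, dq] using h1
  · have : (h0q : ℝ) = 79294 / 100000 := by norm_num [h0q]
    rw [this]; simpa [dq] using h2

/-! ## Reading the box theorem: the named pieces -/

/-- Scaling the coefficients of a term list scales its value. [folklore] -/
theorem evalQR_map_scale (q : ℚ) (ts : List (Term 195)) (v : Fin 195 → ℝ) :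
    evalQR (ts.map fun t => (q * t.1, t.2)) v = (q : ℝ) * evalQR ts v := by
  induction ts with
  | nil => simp
  | cons t ts ih => simp only [List.map_cons, evalQR_cons] at ih ⊢; rw [ih]; push_cast; ring

/-- `E_A(v) = (β-box readout majorant)(v) + (1/30)·‖u‖²_G − Π(u)`. [folklore] -/
theorem evalQR_EA (v : Fin 195 → ℝ) :
    evalQR EA v = evalQR (emajS siteA etab442 dq) v + (mBox : ℝ) * evalQR normL v - evalQR projL v := by
  simp only [EA, fixedE, evalQR_append, evalQR_map_scale]
  have : evalQR (projL.map fun t => (-t.1, t.2)) v = -evalQR projL v := by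
    have h := evalQR_map_scale (-1) projL v
    simp only [neg_mul, one_mul] at h
    rw [h]; push_cast; ring
  rw [this]; ring

/-- SUPPLY of the symbolic model at `(a,h)`, parity A: `Σ_d [½W′(s_d(a,h))·g_c·(e_d − W V_d(a,h))_c² + W″(s_d(a,h))·⟨V_d(a,h), e_d⟩²]`
(`W` = the free rotation `θ`). [folklore] -/
noncomputable def supplyA (a h : ℝ) (v : Fin 195 → ℝ) : ℝ := evalS (reindex K keysA (supplyS siteA)) (fun k => tA k a h) v
/-- TRANSFERS at parity A (tables fixed; the elongations `⟨V_s(a,h), e⟩` move with `(a,h)`). [folklore] -/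
noncomputable def transferA (a h : ℝ) (v : Fin 195 → ℝ) : ℝ :=
  evalS (reindex K keysA (transferS siteA tableClasses)) (fun k => tA k a h) v
/-- MINUS the κ-demand at `(a,h)`, parity A (the builder carries the sign). [folklore] -/
noncomputable def negKappaA (a h : ℝ) (v : Fin 195 → ℝ) : ℝ := evalS (reindex K keysA (kappaS siteA)) (fun k => tA k a h) v
/-- MINUS the readout form of the table `β̄` at `(a,h)`, parity A. [folklore] -/
noncomputable def negReadoutA (a h : ℝ) (v : Fin 195 → ℝ) : ℝ :=
  evalS (reindex K keysA (readoutS siteA betaTable)) (fun k => tA k a h) v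
/-- The S-procedure PENALTY `300·Σ_k (J_kk(a,h)θ_k − RHS_k(a,h)(u))²` (zero at the least-squares co-rotation). [folklore] -/
noncomputable def penaltyA (a h : ℝ) (v : Fin 195 → ℝ) : ℝ := evalS (reindex K keysA (penaltyS siteA)) (fun k => tA k a h) v

/-- The symbolic model splits into its named pieces. [folklore] -/
theorem evalS_tsA (a h : ℝ) (v : Fin 195 → ℝ) :
    evalS tsA (fun k => tA k a h) v = supplyA a h v + transferA a h v + negKappaA a h v + negReadoutA a h v + penaltyA a h v := by
  simp only [tsA, modelA, modelS, reindex, List.map_append, evalS_append, supplyA, transferA, negKappaA, negReadoutA,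
    penaltyA, add_assoc]

/-- **BOX THEOREM, parity A, in words**: for every `(a,h)` of the certified enclosure of the hcp-family minimiser and every
`v = (u, θ)`:  `(β-box majorant)(v) + (1/30)‖u‖²_G − Π(u) ≤ S(a,h)(v) + T(a,h)(v) − κ(a,h)(v) − R(a,h,β̄)(v) + penalty(a,h)(v)`.
At `θ` = the least-squares co-rotation the penalty vanishes, on zero-mean fields `Π = 0`, and for any design `β′` with
`|β′ − β̄| ≤ E` the majorant absorbs `R(β′) − R(β̄)`: the joint sitewise LMI of the 4×4×2 model holds with margin `1/30` AT EVERY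
`(a,h)` OF THE BOX (cf. …TorusModel442A: margin `39101/2²⁰` at the centre only).  Finite model; NOT the stub. [folklore] -/
theorem boxA_read {a h : ℝ} (ha : |a - a0q| ≤ dq) (hh : |h - h0q| ≤ dq) (v : Fin 195 → ℝ) :
    evalQR (emajS siteA etab442 dq) v + (mBox : ℝ) * evalQR normL v - evalQR projL v ≤
      supplyA a h v + transferA a h v + negKappaA a h v + negReadoutA a h v + penaltyA a h v := by
  rw [← evalQR_EA, ← evalS_tsA]; exact boxA ha hh v

open Summit.AtomisticToContinuum.Crystallization.Theorems.StrictSplittingRuleBirth in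
/-- The same AT THE EXACT hcp-family minimiser. [folklore] -/
theorem boxA_read_of_hcpFamilyMin {a h : ℝ} (ha : 0 < a) (hh : 0 < h) (hfam : HcpFamilyMin a h) (v : Fin 195 → ℝ) :
    evalQR (emajS siteA etab442 dq) v + (mBox : ℝ) * evalQR normL v - evalQR projL v ≤
      supplyA a h v + transferA a h v + negKappaA a h v + negReadoutA a h v + penaltyA a h v := by
  rw [← evalQR_EA, ← evalS_tsA]; exact boxA_of_hcpFamilyMin ha hh hfam v

end Param442

end Summit.AtomisticToContinuum.Crystallization.Theorems.StrictSplittingRuleTorusLMI
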